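/-
Copyright (c) 2026 the pub-hodgecm-mathlib formalisation cell (harness21).  Prover seat hodgecm-mathlib-F0P3b-p01 (g26); E1 keeper ∕ dealer F0P3a-p03 (g30)
DEAL 2026-09-03T03:57:29Z «row 64 … if the answer is «rider only», you type it after row 63's generic file is ★ (`Theorems/F0P3cStCharTSLdsRealisation.lean` `--as helper`)»
and «= VERDICT + CUT (A)+(B)» 04:01:05Z (E1 BRICK LEDGER row 64-C, the rider).
-/
import Summits.HodgeConjecture.HodgeConjecture.Theorems.F0P3cStCharTSLdsLabelledPair        -- ★ row 64-B (this seat): `ldsLabelledPair_of_two_constituents`; brings ★ N3-holds, ★ `isAdmissible_cmPrincipalSeries`, ★ `deltaChar_cmBorel_eq_one`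
import Summits.HodgeConjecture.HodgeConjecture.Theorems.F0P3bCentralCharacterUnitaryNonsplit -- ★ `exists_isOpen_isCompact_subgroup_cmLocal` (the compact open `K` of admissible Schur)
import Literature.NumberTheory.Automorphic.IrreducibleEmbeddingSchurPair                     -- ★ row 63 (F0P3-p02 (g27)) p853497: `IrrClass.exists_realisation_schurPair`
import HarnessLib

/-!
# F0 · P3c · «StCharTS» K4′ column — E1 row 64-C «THE L.D.S. REALISATION»: (d1′)+(b′) of the K4′ SENTENCE at the CM datum — each member of `Π(θ) = JH(i_B(θ̃))` realised
# as an invariant irreducible SUB `A` of `I₀ = i_B(θ̃)` with `Hom_G(A, I₀ ∕ A) = 0`, Schur `dim End_G(A) = 1`, the other member as the quotient, and `r_B(I₀ ∕ A) ≠ 0`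
# [Rogawski1990, §12.2 (3) pp. 173–174; Keys1984 §7 Thm. (1) p. 126; Casselman1995 §7.1, Cor. 6.3.9 (b), Thm 3.2.4]

Cell `pub/hodgecm-mathlib`, crux H413 = `stmt-HodgeConjecture-24833` (`--supports` lane, `--as helper`-class: THEOREMS ONLY, no definition ∕ instance ∕ notation ∕ named fact ∕ `sorry`),
route HCCMUnconditional.  E1 BRICK LEDGER (keeper F0P3a-p03 (g30)) row 64-C = the RIDER foreseen in the 03:57:29Z deal: ONE call of E1 row 63's TARGET-AGNOSTIC package ★
`Literature.NumberTheory.Automorphic.IrrClass.exists_realisation_schurPair` (F0P3-p02 (g27), p853497) at `t := cmBorelTriple L 3 v`, `θ₂ := χ = cmTorusCharPair L v χ₁ χ₂`,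
`θ₁ := wχ = cmWeylTorusCharPair L v χ₁ χ₂`, fed by ★ row 64-B `F0P3cStCharTSLdsLabelledPair.ldsLabelledPair_of_two_constituents` (`(hne) (hJH) (hs) (hn)`), ★ `isAdmissible_cmPrincipalSeries`
(`hadm`), ★ N3 `u3PrincipalSeriesLengthLeTwo_holds` (`hlen`), ★ `deltaChar_cmBorel_eq_one` (`hδ`), ★ `exists_isOpen_isCompact_subgroup_cmLocal` (`K`).
Namespace `Summit.HodgeConjecture.HodgeConjecture.Cruxes.H413.F0P3cStCharTSLdsRealisation`.

THE MATHEMATICS.  `G = Gqs L v = U(Φ₃)(L⁺_v)`, `v` non-split (`hns`), `χ = (χ₁, χ₂)` continuous with `χ₁|_{F_v^×} ≡ 1` (case (3), `wχ = χ`), `I₀ := i_B(χ) = normalizedInd t (𝟙 ⊗ χ)`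
(= ★ `cmPrincipalSeries L 3 v χ` by two δ-steps).  GIVEN two distinct constituents (`htwo` — rung 0's `hLdsTwo` ⟺ «LDS-REDUCIBLE-TWO», Keys' (R1)+(R2), PRINT, carried): there are
classes `πs ≠ πn` with `JH(I₀) = {πn, πs}` and an invariant submodule `A ≤ I₀` (`hAinv`) with `hAirr` (no invariant submodule strictly between `0` and `A`), `hHom0`
(`Hom_G(I₀|_A, I₀∕A) = 0`), `hSchur` (`dim End_G(I₀|_A) = 1`), `⟦I₀|_A⟧ = πs`, `⟦I₀∕A⟧ = πn`, and `r_B(I₀∕A) ≠ 0` — the letters `(A hAinv hAirr hHom0 hSchur)` of the K4′ SENTENCE ★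
`F0P3cStCharTSK4PrimeSelfExtSplitSentence.selfExtension_splits_of_jacquet_selfExtension_of_jet_intertwiner` at `χ₁ := 𝟙 ⊗ θ̃` ((d1′)), and (b′)'s «`r_B(π^±)` is the `θ̃`-line»
is ★ 64-B's `hs`∕`hn` (both `≅ 𝟙 ⊗ θ̃`, `wθ̃ = θ̃`).  By symmetry (`htwo` is symmetric and the package is applied to whichever member 64-B puts first) the consumer obtains the
realisation of EITHER member as the sub by swapping `c₁, c₂` — not needed for the SENTENCE, which quantifies over `A`.
HONEST LABEL: count-neutral datum rider; the only non-★ binder is `htwo` = rung 0's (R1)+(R2) [Keys1984 §7 Thm. (1); Rogawski1990 p. 174], carried not asserted; K4′'s residue after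
this row = (J∀occ) + `htwo`; h413 OPEN; HC_CM is proved only modulo the 7 printed citations (2 remaining named inputs hLiu418 = stmt-HodgeConjecture-24832, h413 =
stmt-HodgeConjecture-24833) until rung 0 closes.

## References
* [Rogawski1990] J. D. Rogawski, *Automorphic Representations of Unitary Groups in Three Variables*, Ann. of Math. Stud. 123 (1990), §12.2 p. 173 ll. 8–12 and (3) pp. 173–174.
* [Keys1984] D. Keys, *Principal series representations of special unitary groups over local fields*, Compositio Math. 51 (1984), §7 Thm. p. 126.
* [Casselman1995] W. Casselman, *Introduction to the theory of admissible representations of p-adic reductive groups* (draft 1995), Thm 3.2.4, Cor. 6.3.9 (b), §7.1 Cor. 7.1.2.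
* [BernsteinZelevinsky1977] I. N. Bernstein, A. V. Zelevinsky, *Induced representations of reductive p-adic groups I*, Ann. Sci. ÉNS 10 (1977), Prop. 1.9 (b), §2.3.
* [BushnellHenniart2006] C. J. Bushnell, G. Henniart, *The Local Langlands Conjecture for GL(2)*, Grundlehren 335 (2006), §1.1, §2 (Schur's lemma for smooth irreducibles).
-/

set_option autoImplicit false
-- the mandated namespace has the single-problem summit's repeated segment (`HodgeConjecture.HodgeConjecture`)
set_option linter.dupNamespace false

noncomputable section

open NumberField IsDedekindDomain
open scoped Matrix
open Literature.NumberTheory.Rogawski1990 Literature.NumberTheory.Automorphic Literature.NumberTheory.Automorphic.UnitaryGroup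
open Summit.HodgeConjecture.HodgeConjecture.Cruxes.H413

namespace Summit.HodgeConjecture.HodgeConjecture.Cruxes.H413.F0P3cStCharTSLdsRealisation

variable (L : Type) [Field L] [NumberField L] [IsCMField L] (v : HeightOneSpectrum (𝓞 ↥(maximalRealSubfield L)))

set_option synthInstance.maxHeartbeats 400000 in
set_option maxHeartbeats 20000000 in  -- `cmPrincipalSeries L 3 v χ = normalizedInd (cmBorelTriple L 3 v) (𝟙 ⊗ χ)` by δ at the CM carrier (★ `F0P3KeysLabelledPair` ELABORATION NOTE class)
/-- **E1 ROW 64-C — THE L.D.S. REALISATION ((d1′)+(b′) of the K4′ SENTENCE at the CM datum).**  At a finite place `v` of `L⁺` non-split in `L`, for continuous `χ₁, χ₂` with `χ₁`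
trivial on the `σ`-fixed units (case (3)): IF `i_G(χ₁, χ₂)` has two distinct constituents (`htwo`, rung 0's `hLdsTwo` residue, carried), THEN there are classes `πs ≠ πn`, the
constituents of `I₀ := normalizedInd (cmBorelTriple L 3 v) (𝟙 ⊗ χ)` (`= i_G(χ)`) being exactly `πn, πs`, and an invariant `A ≤ I₀` with: no invariant submodule strictly between
`⊥` and `A` (`hAirr`), `Hom_G(I₀|_A, I₀∕A) = 0` (`hHom0`), `dim End_G(I₀|_A) = 1` (`hSchur`), `⟦I₀|_A⟧ = πs`, `⟦I₀∕A⟧ = πn`, and `r_B(I₀∕A) ≠ 0`.  ONE call of ★ row 63's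
`IrrClass.exists_realisation_schurPair` at `θ₂ := cmTorusCharPair L v χ₁ χ₂`, `θ₁ := cmWeylTorusCharPair L v χ₁ χ₂` over ★ 64-B, ★ `isAdmissible_cmPrincipalSeries`, ★ N3, ★
`deltaChar_cmBorel_eq_one`, ★ `exists_isOpen_isCompact_subgroup_cmLocal`.
[cite: Rogawski1990, §12.2 (3) pp. 173–174] [cite: Keys1984, §7 Thm. p. 126] [cite: Casselman1995, L. 7.1.1 (a), Cor. 7.1.2, Cor. 6.3.9 (b), Prop. 6.4.1, Thm 3.2.4]
[cite: BernsteinZelevinsky1977, Prop. 1.9, Cor. 2.13 (c)] [cite: BushnellHenniart2006, §1.1, §2] -/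
theorem exists_ldsRealisation_schurPair (hns : ∀ w : PlacesOver L v, IsCMField.complexConj L • w.1 = w.1)
    (χ₁ : (LocalRing L v)ˣ →* ℂˣ) (χ₂ : ↥(normOneUnits (conjLocal L (IsCMField.complexConj L) v)) →* ℂˣ)
    (hc1 : Continuous (fun x => ((χ₁ x : ℂˣ) : ℂ))) (hc2 : Continuous (fun x => ((χ₂ x : ℂˣ) : ℂ)))
    (htriv : ∀ a : (LocalRing L v)ˣ, (conjLocal L (IsCMField.complexConj L) v) (a : LocalRing L v) = a → χ₁ a = 1)
    (htwo : ∃ c₁ c₂ : IrrClass (Gqs L v), c₁ ≠ c₂ ∧ c₁.IsConstituentOf (cmPrincipalSeries L 3 v (cmTorusCharPair L v χ₁ χ₂)) ∧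
      c₂.IsConstituentOf (cmPrincipalSeries L 3 v (cmTorusCharPair L v χ₁ χ₂))) :
    haveI := locallyCompactSpace_cmBorelU L 3 v
    ∃ πs πn : IrrClass (Gqs L v), πs ≠ πn ∧
      (∀ c : IrrClass (Gqs L v), c.IsConstituentOf (cmPrincipalSeries L 3 v (cmTorusCharPair L v χ₁ χ₂)) ↔ (c = πn ∨ c = πs)) ∧
      ∃ (A : Submodule ℂ (Representation.SmoothInd (cmBorelTriple L 3 v).P
            (Representation.twist (((Representation.trivial ℂ ↥(cmBorelTriple L 3 v).M ℂ).twist (cmTorusCharPair L v χ₁ χ₂)).comp (cmBorelTriple L 3 v).proj)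
              (rootDeltaChar (cmBorelTriple L 3 v).P))))
        (hAinv : ∀ g, A ≤ A.comap (Representation.normalizedInd (cmBorelTriple L 3 v)
          ((Representation.trivial ℂ ↥(cmBorelTriple L 3 v).M ℂ).twist (cmTorusCharPair L v χ₁ χ₂)) g)),
        (∀ B : Submodule ℂ _, B ≤ A →
            (∀ g, B ≤ B.comap (Representation.normalizedInd (cmBorelTriple L 3 v)
              ((Representation.trivial ℂ ↥(cmBorelTriple L 3 v).M ℂ).twist (cmTorusCharPair L v χ₁ χ₂)) g)) → B = ⊥ ∨ B = A) ∧
        (∀ ψ : Representation.IntertwiningMap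
            ((Representation.normalizedInd (cmBorelTriple L 3 v) ((Representation.trivial ℂ ↥(cmBorelTriple L 3 v).M ℂ).twist (cmTorusCharPair L v χ₁ χ₂))).subrepresentation A hAinv)
            ((Representation.normalizedInd (cmBorelTriple L 3 v) ((Representation.trivial ℂ ↥(cmBorelTriple L 3 v).M ℂ).twist (cmTorusCharPair L v χ₁ χ₂))).quotient A hAinv),
            ψ = 0) ∧
        Module.finrank ℂ (Representation.IntertwiningMap
            ((Representation.normalizedInd (cmBorelTriple L 3 v) ((Representation.trivial ℂ ↥(cmBorelTriple L 3 v).M ℂ).twist (cmTorusCharPair L v χ₁ χ₂))).subrepresentation A hAinv)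
            ((Representation.normalizedInd (cmBorelTriple L 3 v) ((Representation.trivial ℂ ↥(cmBorelTriple L 3 v).M ℂ).twist (cmTorusCharPair L v χ₁ χ₂))).subrepresentation A hAinv)) = 1 ∧
        (∃ (hirr : ((Representation.normalizedInd (cmBorelTriple L 3 v)
              ((Representation.trivial ℂ ↥(cmBorelTriple L 3 v).M ℂ).twist (cmTorusCharPair L v χ₁ χ₂))).subrepresentation A hAinv).IsIrreducible)
            (hsm : ((Representation.normalizedInd (cmBorelTriple L 3 v)
              ((Representation.trivial ℂ ↥(cmBorelTriple L 3 v).M ℂ).twist (cmTorusCharPair L v χ₁ χ₂))).subrepresentation A hAinv).IsSmooth),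
          IrrClass.mk (SmoothIrrep.mk ↥A _ hirr hsm) = πs) ∧
        (∃ (hirr : ((Representation.normalizedInd (cmBorelTriple L 3 v)
              ((Representation.trivial ℂ ↥(cmBorelTriple L 3 v).M ℂ).twist (cmTorusCharPair L v χ₁ χ₂))).quotient A hAinv).IsIrreducible)
            (hsm : ((Representation.normalizedInd (cmBorelTriple L 3 v)
              ((Representation.trivial ℂ ↥(cmBorelTriple L 3 v).M ℂ).twist (cmTorusCharPair L v χ₁ χ₂))).quotient A hAinv).IsSmooth),
          IrrClass.mk (SmoothIrrep.mk (_ ⧸ A) _ hirr hsm) = πn) ∧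
        Nontrivial ((cmBorelTriple L 3 v).restrict ((Representation.normalizedInd (cmBorelTriple L 3 v)
          ((Representation.trivial ℂ ↥(cmBorelTriple L 3 v).M ℂ).twist (cmTorusCharPair L v χ₁ χ₂))).quotient A hAinv)).Coinvariants := by
  haveI := locallyCompactSpace_cmBorelU L 3 v
  obtain ⟨K, hKo, hKc⟩ := F0P3bCentralCharacterUnitaryNonsplit.exists_isOpen_isCompact_subgroup_cmLocal L 3 v
  have hadm := F0P3XiUnramNonsplitInstance.isAdmissible_cmPrincipalSeries L v (cmTorusCharPair L v χ₁ χ₂)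
  have hlen := F0P3U3PrincipalSeriesLettersHold.u3PrincipalSeriesLengthLeTwo_holds L v hns χ₁ χ₂ hc1 hc2
  have H := F0P3cStCharTSLdsLabelledPair.ldsLabelledPair_of_two_constituents L v hns χ₁ χ₂ hc1 hc2 htriv htwo
  cases H with
  | intro πs H =>
  cases H with
  | intro πn H =>
  cases H with
  | intro hne H =>
  cases H with
  | intro hJH H =>
  cases H with
  | intro hs hn =>
  exact ⟨πs, πn, hne, hJH, IrrClass.exists_realisation_schurPair (cmBorelTriple L 3 v) (F0P2nBorelCharactersUnipotent.deltaChar_cmBorel_eq_one L v)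
    hadm hKo hKc hlen hne hJH hs hn⟩

end Summit.HodgeConjecture.HodgeConjecture.Cruxes.H413.F0P3cStCharTSLdsRealisation

end
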